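import Mathlib
import Literature.MathematicalPhysics.QuantumLattice.GermMarkov
import Literature.MathematicalPhysics.QuantumLattice.BallSpecification
import Literature.MathematicalPhysics.QuantumLattice.ShellToGermMarkov
import Literature.Probability.Independence.IndepCondExp
import HarnessLib

/-!
# `BallSpecifiedFieldLimit` — stub `stub_oneSidedGermOfMI` (stmt-CriticalPhenomena-11247), proved

THEOREM-ONLY file. Registered stub `stub_oneSidedGermOfMI` (B2) of the line `registered`
(`Cruxes/BallSpecifiedFieldLimit/Lines/birth.lean`), Ising-free measure theory on `𝓢'(E)`: McKean's
TWO-SIDED germ-Markov property on every ball `B(c, R)` in projection form (MI: for bounded `F`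
measurable for the inner germ `G⁻ = ⋂_ε extEvents (B(c,R)^ε)`, `μ[F | G⁺ ∨ Γ] = μ[F | Γ]`, `G⁺` the
germ of the closed complement, `Γ` the germ of the sphere) together with splitting of the test
functions at every sphere modulo `μ` (SPLIT) gives the ONE-SIDED a.e. germ-Markov property: every
interior event `A ∈ extEvents (ball c r)` has a `germEvents c r`-measurable version of
`μ[A | extEvents (closedBall c r)ᶜ]` — verbatim the hypothesis of the landed kernel lemma
`stub_properGermKernels`.

Proof (Rozanov, *Markov Random Fields* (1982), Ch. 2 §1.1, §1.3). Fix `η > 0`, `R = r + η`.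
* `condIndepCondExp_of_condExp_indicator_ae_eq` (generic splitting algebra, tower + pull-out): a
  common `m'`-version of the `M₂`-conditional probabilities of `m₁`-events makes every
  `m' ≤ M ≤ M₂ ⊇ m₂` split `m₁` and `m₂`; hence (MI) ⇒ `Γ` splits `G⁻`, `G⁺`
  (`condIndepCondExp_of_condExp_ae_eq_sup`), and a splitting σ-algebra may be enlarged by a piece of
  either side (`condIndepCondExp_sup_of_le`): `Z = Γ ∨ N`, `N = extEvents (B(c,R) ∖ B̄(c,r)) ≤ G⁻`,
  splits `G⁻`, `G⁺`, so `μ (A ∩ B') = ∫⁻_{B'} μ⟦A | Z⟧` on `Z ∨ G⁺`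
  (`CondIndepCondExp.measure_inter_eq_setLIntegral`, file `ShellToGermMarkov`).
* `exists_measurableSet_ae_eq_of_eval_ae_eq`: by (SPLIT) at the sphere `∂B(c, R)` every exterior
  event `B ∈ extEvents (closedBall c r)ᶜ` is a.e. equal to some `B' ∈ Z ∨ G⁺` (the a.e.-shadow of a
  σ-algebra is a σ-algebra containing the generators).
* `Z ≤ extEvents (B(c, r + 2η) ∖ B̄(c, r))` (the `η/2`-collar of the sphere lies in the shell), so
  `μ⟦A | Z⟧` is a shell version of width `2η` (`exists_shellVersion_of_split_of_MI`), and
  `exists_germMeasurable_of_forall_shell` (`limsup` over the widths `1/(n+1)`, verbatim the end of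
  `exists_germMeasurable_version_of_shellSplitting`) produces the germ-measurable version.
-/

noncomputable section

namespace Summit.CriticalPhenomena.Ising3DConformalLimit.Theorems

open MeasureTheory ProbabilityTheory Set Filter Metric
open scoped ENNReal SchwartzMap
open Literature.MathematicalPhysics.QuantumLattice

/-! ### Splitting algebra (generic measurable space) -/

section Splitting

variable {Ω : Type*}

/-- **Splitting from a common version of the conditional probabilities.** Let `m' ≤ M ≤ M₂ ≤ m₀`,
`m₁ ≤ m₀`, `m₂ ≤ M₂`, `μ` finite, and suppose that for every `s ∈ m₁` the conditional probability
`μ⟦s | m'⟧` is a version of `μ⟦s | M₂⟧`. Then `M` splits `m₁` and `m₂`: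
`μ⟦s ∩ t | M⟧ = μ⟦s | M⟧ μ⟦t | M⟧` a.e. for `s ∈ m₁`, `t ∈ m₂` (tower property through `M₂` and
pull-out; Rozanov 1982, Ch. 2 §1.1, (1.4) ⇒ (1.1)). [folklore] -/
theorem condIndepCondExp_of_condExp_indicator_ae_eq {m' M M₂ m₁ m₂ m₀ : MeasurableSpace Ω}
    {μ : Measure Ω} [IsFiniteMeasure μ] (hm'M : m' ≤ M) (hMM₂ : M ≤ M₂) (hM₂ : M₂ ≤ m₀)
    (hm₁ : m₁ ≤ m₀) (hm₂ : m₂ ≤ M₂)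
    (h : ∀ s : Set Ω, MeasurableSet[m₁] s → μ⟦s | M₂⟧ =ᵐ[μ] μ⟦s | m'⟧) :
    CondIndepCondExp M m₁ m₂ μ := by
  intro s t hs ht
  have hM : M ≤ m₀ := hMM₂.trans hM₂
  have hsΩ : MeasurableSet[m₀] s := hm₁ s hs
  have htM₂ : MeasurableSet[M₂] t := hm₂ t ht
  have htΩ : MeasurableSet[m₀] t := hM₂ t htM₂
  have hst : (s ∩ t).indicator (fun _ => (1 : ℝ)) =
      (s.indicator fun _ => (1 : ℝ)) * t.indicator fun _ => (1 : ℝ) := by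
    funext x
    by_cases hx : x ∈ s <;> by_cases hx' : x ∈ t <;> simp [hx, hx']
  have hsi : Integrable (s.indicator fun _ => (1 : ℝ)) μ := (integrable_const 1).indicator hsΩ
  have hti : Integrable (t.indicator fun _ => (1 : ℝ)) μ := (integrable_const 1).indicator htΩ
  have hsti : Integrable ((s.indicator fun _ => (1 : ℝ)) * t.indicator fun _ => (1 : ℝ)) μ := by
    rw [← hst]
    exact (integrable_const 1).indicator (hsΩ.inter htΩ)
  have hprod : μ⟦s | m'⟧ * (t.indicator fun _ => (1 : ℝ)) = t.indicator (μ⟦s | m'⟧) := by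
    funext x
    by_cases hx : x ∈ t <;> simp [hx]
  have hprodi : Integrable (μ⟦s | m'⟧ * t.indicator fun _ => (1 : ℝ)) μ := by
    rw [hprod]
    exact integrable_condExp.indicator htΩ
  -- (i) the `M`-conditional probability of `s` is the `m'`-version
  have h1 : μ⟦s | M⟧ =ᵐ[μ] μ⟦s | m'⟧ :=
    calc μ⟦s | M⟧ =ᵐ[μ] μ[μ⟦s | M₂⟧ | M] := (condExp_condExp_of_le hMM₂ hM₂).symm
      _ =ᵐ[μ] μ[μ⟦s | m'⟧ | M] := condExp_congr_ae (h s hs)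
      _ = μ⟦s | m'⟧ := condExp_of_stronglyMeasurable hM
          (stronglyMeasurable_condExp.mono hm'M) integrable_condExp
  -- (ii) pull `1_t` out of the `M₂`-conditional expectation and insert the `m'`-version
  have h2 : μ[(s.indicator fun _ => (1 : ℝ)) * t.indicator (fun _ => (1 : ℝ)) | M₂] =ᵐ[μ]
      μ⟦s | m'⟧ * t.indicator fun _ => (1 : ℝ) := by
    have hpull : μ[(s.indicator fun _ => (1 : ℝ)) * t.indicator (fun _ => (1 : ℝ)) | M₂] =ᵐ[μ]
        μ⟦s | M₂⟧ * t.indicator fun _ => (1 : ℝ) :=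
      condExp_mul_of_stronglyMeasurable_right (stronglyMeasurable_const.indicator htM₂) hsti hsi
    filter_upwards [hpull, h s hs] with x hx hx'
    rw [hx, Pi.mul_apply, Pi.mul_apply, hx']
  calc μ⟦s ∩ t | M⟧
      = μ[(s.indicator fun _ => (1 : ℝ)) * t.indicator (fun _ => (1 : ℝ)) | M] := by rw [hst]
    _ =ᵐ[μ] μ[μ[(s.indicator fun _ => (1 : ℝ)) * t.indicator (fun _ => (1 : ℝ)) | M₂] | M] :=
        (condExp_condExp_of_le hMM₂ hM₂).symm
    _ =ᵐ[μ] μ[μ⟦s | m'⟧ * t.indicator (fun _ => (1 : ℝ)) | M] := condExp_congr_ae h2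
    _ =ᵐ[μ] μ⟦s | m'⟧ * μ⟦t | M⟧ :=
        condExp_mul_of_stronglyMeasurable_left (stronglyMeasurable_condExp.mono hm'M) hprodi hti
    _ =ᵐ[μ] μ⟦s | M⟧ * μ⟦t | M⟧ := by
        filter_upwards [h1] with x hx
        rw [Pi.mul_apply, Pi.mul_apply, hx]

/-- **McKean's projection form implies splitting.** If `m' ≤ m₂ ≤ m₀`, `m₁ ≤ m₀`, `μ` is finite
and `μ[F | m₂ ∨ m'] = μ[F | m']` a.e. for every bounded `m₁`-measurable real `F`, then `m'` splits
`m₁` and `m₂` (`CondIndepCondExp m' m₁ m₂ μ`; take `F = 1_s`). [folklore] -/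
theorem condIndepCondExp_of_condExp_ae_eq_sup {m' m₁ m₂ m₀ : MeasurableSpace Ω} {μ : Measure Ω}
    [IsFiniteMeasure μ] (hm'₂ : m' ≤ m₂) (hm₂ : m₂ ≤ m₀) (hm₁ : m₁ ≤ m₀)
    (h : ∀ F : Ω → ℝ, Measurable[m₁] F → (∃ C : ℝ, ∀ ω, |F ω| ≤ C) →
      μ[F | m₂ ⊔ m'] =ᵐ[μ] μ[F | m']) :
    CondIndepCondExp m' m₁ m₂ μ := by
  refine condIndepCondExp_of_condExp_indicator_ae_eq le_rfl hm'₂ hm₂ hm₁ le_rfl fun s hs => ?_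
  have hF : Measurable[m₁] (s.indicator fun _ => (1 : ℝ)) := measurable_const.indicator hs
  have hb : ∃ C : ℝ, ∀ ω, |s.indicator (fun _ => (1 : ℝ)) ω| ≤ C :=
    ⟨1, fun ω => by by_cases hω : ω ∈ s <;> simp [hω]⟩
  have key := h _ hF hb
  rwa [sup_eq_left.2 hm'₂] at key

/-- **Enlarging a splitting σ-algebra by a piece of one side.** If `m'` splits `m₁` and `m₂` under
the finite measure `μ` (all `≤ m₀`) and `n ≤ m₁`, then `m' ∨ n` splits `m₁` and `m₂` as well
(Rozanov 1982, Ch. 2 §1.1: for `t ∈ m₂`, `μ⟦t | m'⟧` is a version of `μ⟦t | m' ∨ m₁⟧`,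
`CondIndepCondExp.condExp_indicator_ae_eq_sup`, and `m' ≤ m' ∨ n ≤ m' ∨ m₁`). [folklore] -/
theorem condIndepCondExp_sup_of_le {m' m₁ m₂ n m₀ : MeasurableSpace Ω} {μ : Measure Ω}
    [IsFiniteMeasure μ] (hm' : m' ≤ m₀) (hm₁ : m₁ ≤ m₀) (hm₂ : m₂ ≤ m₀)
    (h : CondIndepCondExp m' m₁ m₂ μ) (hn : n ≤ m₁) : CondIndepCondExp (m' ⊔ n) m₁ m₂ μ := by
  have key : ∀ t : Set Ω, MeasurableSet[m₂] t → μ⟦t | m' ⊔ m₁⟧ =ᵐ[μ] μ⟦t | m'⟧ := fun t ht =>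
    (h.symm.condExp_indicator_ae_eq_sup hm' hm₂ hm₁ ht).symm
  exact (condIndepCondExp_of_condExp_indicator_ae_eq (M := m' ⊔ n) (M₂ := m' ⊔ m₁) le_sup_left
    (sup_le_sup_left hn _) (sup_le hm' hm₁) hm₂ le_sup_right key).symm

end Splitting

/-! ### Random fields: events modulo null sets, shells and germs -/

section FieldConfig

variable {E : Type*} [NormedAddCommGroup E] [NormedSpace ℝ E]

/-- **Region events modulo null sets.** If every evaluation `ω ↦ ω f` at a test function supported
in `V` is `μ`-a.e. equal to a `W`-measurable function, then every event of `extEvents V` is `μ`-a.e.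
equal to a `W`-measurable event (the class of sets a.e. equal to a `W`-set is a σ-algebra containing
the generators `(ω ↦ ω f) ⁻¹' O`, `O` Borel). [folklore] -/
theorem exists_measurableSet_ae_eq_of_eval_ae_eq {μ : Measure (FieldConfig E)} {V : Set E}
    {W : MeasurableSpace (FieldConfig E)}
    (h : ∀ f : 𝓢(E, ℝ), tsupport f ⊆ V →
      ∃ φ : FieldConfig E → ℝ, Measurable[W] φ ∧ (fun ω : FieldConfig E => ω f) =ᵐ[μ] φ)
    {B : Set (FieldConfig E)} (hB : MeasurableSet[extEvents V] B) :
    ∃ B' : Set (FieldConfig E), MeasurableSet[W] B' ∧ (B : Set (FieldConfig E)) =ᵐ[μ] B' := by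
  let 𝒞 : MeasurableSpace (FieldConfig E) :=
    { MeasurableSet' := fun B => ∃ B' : Set (FieldConfig E), MeasurableSet[W] B' ∧
        (B : Set (FieldConfig E)) =ᵐ[μ] B'
      measurableSet_empty := ⟨∅, MeasurableSet.empty, EventuallyEq.rfl⟩
      measurableSet_compl := fun B ⟨B', hB', hBB'⟩ => ⟨B'ᶜ, hB'.compl, hBB'.compl⟩
      measurableSet_iUnion := fun F hF => by
        choose F' hF' hFF' using hF
        exact ⟨⋃ i, F' i, MeasurableSet.iUnion hF', Filter.EventuallyEq.countable_iUnion hFF'⟩ }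
  suffices hle : extEvents V ≤ 𝒞 from hle B hB
  refine iSup₂_le fun f hf => ?_
  obtain ⟨φ, hφ, hae⟩ := h f hf
  intro S hS
  obtain ⟨O, hO, rfl⟩ := MeasurableSpace.measurableSet_comap.1 hS
  borelize ℝ
  exact ⟨φ ⁻¹' O, hφ hO, hae.fun_comp (· ∈ O)⟩

/-- **From shell versions at all widths to a germ version** (Rozanov 1982, Ch. 2 §1.3, passage
to (1.29)). Let `μ` be a finite measure on `𝓢'(E)` and `A` an event such that for EVERY `ε > 0`
some `extEvents (ball c (r + ε) ∖ closedBall c r)`-measurable `g_ε ≥ 0` has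
`μ (A ∩ B) = ∫⁻_B g_ε dμ` for all exterior events `B ∈ extEvents (closedBall c r)ᶜ`. Then there is
such a `g` measurable for the germ σ-algebra `germEvents c r`: the versions `g_{1/(n+1)}` are
exterior-measurable with the same integrals on exterior events, hence pairwise a.e. equal, and
`g = limsup_n g_{1/(n+1)}` is measurable for every shell (the shells decrease) and a.e. equal to
`g_1` (the end of the proof of `exists_germMeasurable_version_of_shellSplitting`). [folklore] -/
theorem exists_germMeasurable_of_forall_shell (μ : Measure (FieldConfig E)) [IsFiniteMeasure μ]
    (c : E) (r : ℝ) {A : Set (FieldConfig E)}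
    (h : ∀ ε : ℝ, 0 < ε → ∃ g : FieldConfig E → ℝ≥0∞,
      Measurable[extEvents (ball c (r + ε) \ closedBall c r)] g ∧
        ∀ B : Set (FieldConfig E), MeasurableSet[extEvents (closedBall c r)ᶜ] B →
          μ (A ∩ B) = ∫⁻ η in B, g η ∂μ) :
    ∃ g : FieldConfig E → ℝ≥0∞, Measurable[germEvents c r] g ∧
      ∀ B : Set (FieldConfig E), MeasurableSet[extEvents (closedBall c r)ᶜ] B →
        μ (A ∩ B) = ∫⁻ η in B, g η ∂μ := by
  -- adapted from `Literature/MathematicalPhysics/QuantumLattice/ShellToGermMarkov.lean`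
  choose G hGm hGdlr using fun n : ℕ => h (1 / ((n : ℝ) + 1)) Nat.one_div_pos_of_nat
  have hshell_le : ∀ n : ℕ, extEvents (E := E) (ball c (r + 1 / ((n : ℝ) + 1)) \ closedBall c r) ≤
      extEvents (closedBall c r)ᶜ := fun n => extEvents_mono (sdiff_subset_compl _ _)
  -- all shell versions are a.e. equal to the first one
  have hae : ∀ n : ℕ, G n =ᵐ[μ] G 0 := fun n => by
    have h' : G n =ᵐ[μ.trim (extEvents_le (closedBall c r)ᶜ)] G 0 := by
      refine ae_eq_of_forall_setLIntegral_eq_of_sigmaFinite (μ := μ.trim (extEvents_le _))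
        ((hGm n).mono (hshell_le n) le_rfl) ((hGm 0).mono (hshell_le 0) le_rfl) ?_
      intro B hB _
      rw [setLIntegral_trim _ ((hGm n).mono (hshell_le n) le_rfl) hB,
        setLIntegral_trim _ ((hGm 0).mono (hshell_le 0) le_rfl) hB, ← hGdlr n B hB, hGdlr 0 B hB]
    exact ae_eq_of_ae_eq_trim h'
  have hall : ∀ᵐ η ∂μ, ∀ n, G n η = G 0 η := ae_all_iff.2 hae
  refine ⟨fun η => limsup (fun n => G n η) atTop, ?_, fun B hB => ?_⟩
  · -- germ measurability: the `limsup` only sees the shells of width `≤ ε`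
    refine Measurable.of_comap_le (le_iInf₂ fun ε hε => Measurable.comap_le ?_)
    obtain ⟨N, hN⟩ := exists_nat_one_div_lt hε
    have hle : ∀ n : ℕ,
        extEvents (E := E) (ball c (r + 1 / (((n + N : ℕ) : ℝ) + 1)) \ closedBall c r) ≤
          extEvents (ball c (r + ε) \ closedBall c r) := fun n => by
      refine extEvents_mono (sdiff_subset_sdiff_left (ball_subset_ball ?_))
      have h1 : (1 : ℝ) / (((n + N : ℕ) : ℝ) + 1) ≤ 1 / ((N : ℝ) + 1) :=
        one_div_le_one_div_of_le (by positivity)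
          (by push_cast; linarith [(Nat.cast_nonneg n : (0 : ℝ) ≤ n)])
      linarith
    have heq : (fun η => limsup (fun n => G n η) atTop) =
        fun η => limsup (fun n => G (n + N) η) atTop :=
      funext fun η => (Filter.limsup_nat_add (fun n => G n η) N).symm
    rw [heq]
    exact Measurable.limsup fun n => (hGm (n + N)).mono (hle n) le_rfl
  · -- the DLR identity: `limsup G = G 0` a.e.
    have hg : (fun η => limsup (fun n => G n η) atTop) =ᵐ[μ] G 0 := by
      filter_upwards [hall] with η hη
      rw [show (fun n => G n η) = fun _ => G 0 η from funext hη, Filter.limsup_const]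
    rw [hGdlr 0 B hB]
    exact (lintegral_congr_ae (ae_restrict_of_ae hg)).symm

/-- The two-sided germ σ-algebra of the sphere `∂B(c, r + η)` is seen in the shell
`B(c, r + 2η) ∖ B̄(c, r)` (`η > 0`): the `η/2`-collar of the sphere lies in that shell (triangle
inequality). [folklore] -/
theorem germ_frontier_ball_le_extEvents_shell (c : E) (r : ℝ) {η : ℝ} (hη : 0 < η) :
    (⨅ (ε : ℝ) (_ : 0 < ε), extEvents (E := E) (thickening ε (frontier (ball c (r + η))))) ≤
      extEvents (ball c (r + 2 * η) \ closedBall c r) := by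
  refine iInf₂_le_of_le (η / 2) (half_pos hη) (extEvents_mono fun x hx => ?_)
  obtain ⟨z, hz, hxz⟩ := mem_thickening_iff.1 hx
  have hz' : dist z c = r + η := mem_sphere.1 (frontier_ball_subset_sphere hz)
  have h1 := dist_triangle x z c
  have h2 := dist_triangle z x c
  rw [dist_comm z x] at h2
  refine ⟨?_, ?_⟩
  · rw [mem_ball]
    linarith
  · rw [mem_closedBall, not_le]
    linarith

/-- The germ σ-algebra of the sphere `∂B(c, R)` is contained in the germ σ-algebra of the closed
complement `B(c, R)ᶜ` (the sphere lies in the complement). [folklore] -/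
theorem germ_frontier_ball_le_germ_compl (c : E) (R : ℝ) :
    (⨅ (ε : ℝ) (_ : 0 < ε), extEvents (E := E) (thickening ε (frontier (ball c R)))) ≤
      ⨅ (ε : ℝ) (_ : 0 < ε), extEvents (thickening ε (ball c R)ᶜ) :=
  iInf₂_mono fun ε _ => extEvents_mono (thickening_subset_of_subset ε
    (frontier_ball_subset_sphere.trans sphere_disjoint_ball.subset_compl_right))

/-- The exterior events of the closed ball `B̄(c, R)` are contained in the germ σ-algebra of the
closed complement `B(c, R)ᶜ`. [folklore] -/
theorem extEvents_compl_closedBall_le_germ_compl (c : E) (R : ℝ) :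
    extEvents (E := E) (closedBall c R)ᶜ ≤
      ⨅ (ε : ℝ) (_ : 0 < ε), extEvents (thickening ε (ball c R)ᶜ) :=
  le_iInf₂ fun _ hε => extEvents_mono
    ((compl_subset_compl.2 ball_subset_closedBall).trans (self_subset_thickening hε _))

/-- The events of a region `U ⊆ B(c, R)` are contained in the inner germ σ-algebra
`⋂_ε extEvents (B(c, R)^ε)`. [folklore] -/
theorem extEvents_le_germ_inner {U : Set E} (c : E) (R : ℝ) (hU : U ⊆ ball c R) :
    extEvents (E := E) U ≤ ⨅ (ε : ℝ) (_ : 0 < ε), extEvents (thickening ε (ball c R)) :=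
  le_iInf₂ fun _ hε => extEvents_mono (hU.trans (self_subset_thickening hε _))

/-! ### From the two-sided germ-Markov property to one-sided germ versions -/

/-- **Abstract core.** Let `μ` be a finite measure on `𝓢'(E)` and `Γ ≤ G⁺`, `N ≤ G⁻` sub-σ-algebras
of the Borel σ-algebra such that `μ[F | G⁺ ∨ Γ] = μ[F | Γ]` a.e. for every bounded `G⁻`-measurable
`F` (McKean's Markov property), and such that every evaluation `ω ↦ ω f`, `tsupport f ⊆ V`, is a.e.
equal to a `(Γ ∨ N) ∨ G⁺`-measurable function. Then every `A ∈ G⁻` has a `Γ ∨ N`-measurable `g`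
(namely `μ⟦A | Γ ∨ N⟧`) with `μ (A ∩ B) = ∫⁻_B g dμ` for all `B ∈ extEvents V` (`Γ ∨ N` splits `G⁻`
and `G⁺`; `CondIndepCondExp.measure_inter_eq_setLIntegral` on `(Γ ∨ N) ∨ G⁺`; every `B` is a.e.
equal to an event there). [folklore] -/
theorem exists_version_of_condExp_ae_eq_sup {μ : Measure (FieldConfig E)} [IsFiniteMeasure μ]
    {Gm Gp Γ N : MeasurableSpace (FieldConfig E)} {V : Set E}
    (hGm₀ : Gm ≤ FieldConfig.instMeasurableSpace) (hGp₀ : Gp ≤ FieldConfig.instMeasurableSpace)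
    (hΓGp : Γ ≤ Gp) (hNGm : N ≤ Gm)
    (hMI : ∀ F : FieldConfig E → ℝ, Measurable[Gm] F → (∃ C : ℝ, ∀ ω, |F ω| ≤ C) →
      μ[F | Gp ⊔ Γ] =ᵐ[μ] μ[F | Γ])
    (hgen : ∀ f : 𝓢(E, ℝ), tsupport f ⊆ V →
      ∃ φ : FieldConfig E → ℝ, Measurable[(Γ ⊔ N) ⊔ Gp] φ ∧
        (fun ω : FieldConfig E => ω f) =ᵐ[μ] φ)
    {A : Set (FieldConfig E)} (hA : MeasurableSet[Gm] A) :
    ∃ g : FieldConfig E → ℝ≥0∞, Measurable[Γ ⊔ N] g ∧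
      ∀ B : Set (FieldConfig E), MeasurableSet[extEvents V] B → μ (A ∩ B) = ∫⁻ x in B, g x ∂μ := by
  have hΓ₀ : Γ ≤ FieldConfig.instMeasurableSpace := hΓGp.trans hGp₀
  have hCI : CondIndepCondExp Γ Gm Gp μ :=
    condIndepCondExp_of_condExp_ae_eq_sup hΓGp hGp₀ hGm₀ hMI
  have hCIZ : CondIndepCondExp (Γ ⊔ N) Gm Gp μ := condIndepCondExp_sup_of_le hΓ₀ hGm₀ hGp₀ hCI hNGm
  refine ⟨fun x => ENNReal.ofReal ((μ⟦A | Γ ⊔ N⟧) x),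
    stronglyMeasurable_condExp.measurable.ennreal_ofReal, fun B hB => ?_⟩
  obtain ⟨B', hB', hBB'⟩ := exists_measurableSet_ae_eq_of_eval_ae_eq hgen hB
  rw [measure_congr (ae_eq_set_inter EventuallyEq.rfl hBB'),
    hCIZ.measure_inter_eq_setLIntegral (sup_le hΓ₀ (hNGm.trans hGm₀)) hGm₀ hGp₀ hA hB']
  exact setLIntegral_congr hBB'.symm

/-- **Shell versions from the two-sided germ-Markov property on `B(c, r + η)` and splitting at the
sphere `∂B(c, r + η)`** (`μ` finite, `0 < η`): under (MI) on `B(c, r + η)` in projection form and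
(SPLIT) of the test functions supported off `B̄(c, r)` at the sphere `∂B(c, r + η)` modulo `μ`,
every interior event `A ∈ extEvents (ball c r)` has an
`extEvents (B(c, r + 2η) ∖ B̄(c, r))`-measurable `g` with `μ (A ∩ B) = ∫⁻_B g dμ` for all exterior
events `B` (`exists_version_of_condExp_ae_eq_sup` with `N = extEvents (B(c, r + η) ∖ B̄(c, r))`; the
germ of the sphere is seen in the shell of width `2η`). [folklore] -/
theorem exists_shellVersion_of_split_of_MI (μ : Measure (FieldConfig E)) [IsFiniteMeasure μ]
    (c : E) (r : ℝ) {η : ℝ} (hη : 0 < η)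
    (hsplit : ∀ f : 𝓢(E, ℝ), tsupport f ⊆ (closedBall c r)ᶜ →
      ∃ φ : FieldConfig E → ℝ,
        Measurable[extEvents ((closedBall c r)ᶜ ∩ ball c (r + η)) ⊔
          extEvents ((closedBall c r)ᶜ ∩ (closedBall c (r + η))ᶜ)] φ ∧
        (fun ω : FieldConfig E => ω f) =ᵐ[μ] φ)
    (hMI : ∀ F : FieldConfig E → ℝ,
      Measurable[⨅ (ε : ℝ) (_ : 0 < ε), extEvents (thickening ε (ball c (r + η)))] F →
      (∃ C : ℝ, ∀ ω, |F ω| ≤ C) →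
      μ[F | (⨅ (ε : ℝ) (_ : 0 < ε), extEvents (thickening ε (ball c (r + η))ᶜ)) ⊔
          ⨅ (ε : ℝ) (_ : 0 < ε), extEvents (thickening ε (frontier (ball c (r + η))))] =ᵐ[μ]
        μ[F | ⨅ (ε : ℝ) (_ : 0 < ε), extEvents (thickening ε (frontier (ball c (r + η))))])
    {A : Set (FieldConfig E)} (hA : MeasurableSet[extEvents (ball c r)] A) :
    ∃ g : FieldConfig E → ℝ≥0∞, Measurable[extEvents (ball c (r + 2 * η) \ closedBall c r)] g ∧
      ∀ B : Set (FieldConfig E), MeasurableSet[extEvents (closedBall c r)ᶜ] B →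
        μ (A ∩ B) = ∫⁻ x in B, g x ∂μ := by
  have hGm₀ : (⨅ (ε : ℝ) (_ : 0 < ε), extEvents (E := E) (thickening ε (ball c (r + η)))) ≤
      FieldConfig.instMeasurableSpace := (iInf₂_le (1 : ℝ) one_pos).trans (extEvents_le _)
  have hGp₀ : (⨅ (ε : ℝ) (_ : 0 < ε), extEvents (E := E) (thickening ε (ball c (r + η))ᶜ)) ≤
      FieldConfig.instMeasurableSpace := (iInf₂_le (1 : ℝ) one_pos).trans (extEvents_le _)
  have hNGm : extEvents (E := E) (ball c (r + η) \ closedBall c r) ≤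
      ⨅ (ε : ℝ) (_ : 0 < ε), extEvents (thickening ε (ball c (r + η))) :=
    extEvents_le_germ_inner c (r + η) sdiff_subset
  have hsub : (closedBall c r)ᶜ ∩ ball c (r + η) ⊆ ball c (r + η) \ closedBall c r :=
    fun x hx => ⟨hx.2, hx.1⟩
  have hW : extEvents ((closedBall c r)ᶜ ∩ ball c (r + η)) ⊔
      extEvents ((closedBall c r)ᶜ ∩ (closedBall c (r + η))ᶜ) ≤
      ((⨅ (ε : ℝ) (_ : 0 < ε), extEvents (E := E) (thickening ε (frontier (ball c (r + η))))) ⊔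
        extEvents (ball c (r + η) \ closedBall c r)) ⊔
        ⨅ (ε : ℝ) (_ : 0 < ε), extEvents (thickening ε (ball c (r + η))ᶜ) :=
    sup_le ((extEvents_mono hsub).trans (le_sup_right.trans le_sup_left))
      ((extEvents_mono inter_subset_right).trans
        ((extEvents_compl_closedBall_le_germ_compl c (r + η)).trans le_sup_right))
  obtain ⟨g, hg, hdlr⟩ := exists_version_of_condExp_ae_eq_sup hGm₀ hGp₀
    (germ_frontier_ball_le_germ_compl c (r + η)) hNGm hMI
    (fun f hf => by
      obtain ⟨φ, hφ, hae⟩ := hsplit f hf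
      exact ⟨φ, hφ.mono hW le_rfl, hae⟩)
    (extEvents_le_germ_inner c (r + η) (ball_subset_ball (by linarith)) A hA)
  have hZle :
      ((⨅ (ε : ℝ) (_ : 0 < ε), extEvents (E := E) (thickening ε (frontier (ball c (r + η))))) ⊔
        extEvents (ball c (r + η) \ closedBall c r)) ≤
      extEvents (ball c (r + 2 * η) \ closedBall c r) :=
    sup_le (germ_frontier_ball_le_extEvents_shell c r hη)
      (extEvents_mono (sdiff_subset_sdiff_left (ball_subset_ball (by linarith))))
  exact ⟨g, hg.mono hZle le_rfl, hdlr⟩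

end FieldConfig

/-- **Registered stub `stub_oneSidedGermOfMI` (B2), proved**: for a probability law `μ` on
`𝓢'(ℝ³)` whose test functions split at every sphere modulo `μ` (SPLIT, conclusion of B1) and which
has McKean's two-sided germ-Markov property on every ball in projection form (MI, item
stmt-CriticalPhenomena-11236), every interior event `A ∈ extEvents (ball c r)` (`0 < r`) has a
`germEvents c r`-measurable version `g` of `μ[A | extEvents (closedBall c r)ᶜ]`:
`μ (A ∩ B) = ∫⁻_B g dμ` for all exterior events `B` — the hypothesis of the kernel lemma
`stub_properGermKernels`. Proof: shell versions of every width `ε`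
(`exists_shellVersion_of_split_of_MI` at `η = ε/2`, (SPLIT) with `U = (closedBall c r)ᶜ`), then
`exists_germMeasurable_of_forall_shell`. [folklore] -/
theorem stub_oneSidedGermOfMI :
    ∀ (μ : MeasureTheory.Measure (Literature.MathematicalPhysics.QuantumLattice.FieldConfig (EuclideanSpace ℝ (Fin 3)))),
      MeasureTheory.IsProbabilityMeasure μ →
      (∀ (c : EuclideanSpace ℝ (Fin 3)) (s : ℝ), 0 < s → ∀ (U : Set (EuclideanSpace ℝ (Fin 3))), IsOpen U →
        ∀ f : SchwartzMap (EuclideanSpace ℝ (Fin 3)) ℝ, tsupport (f : EuclideanSpace ℝ (Fin 3) → ℝ) ⊆ U →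
          ∃ φ : Literature.MathematicalPhysics.QuantumLattice.FieldConfig (EuclideanSpace ℝ (Fin 3)) → ℝ,
            Measurable[Literature.MathematicalPhysics.QuantumLattice.extEvents (U ∩ Metric.ball c s) ⊔
              Literature.MathematicalPhysics.QuantumLattice.extEvents (U ∩ (Metric.closedBall c s)ᶜ)] φ ∧
            (fun ω : Literature.MathematicalPhysics.QuantumLattice.FieldConfig (EuclideanSpace ℝ (Fin 3)) => ω f) =ᵐ[μ] φ) →
      (∀ (c : EuclideanSpace ℝ (Fin 3)) (r : ℝ), 0 < r → ∀ F : Literature.MathematicalPhysics.QuantumLattice.FieldConfig (EuclideanSpace ℝ (Fin 3)) → ℝ,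
        Measurable[⨅ (ε : ℝ) (_ : 0 < ε), Literature.MathematicalPhysics.QuantumLattice.extEvents (Metric.thickening ε (Metric.ball c r))] F →
        (∃ C : ℝ, ∀ ω, |F ω| ≤ C) →
        MeasureTheory.condExp ((⨅ (ε : ℝ) (_ : 0 < ε), Literature.MathematicalPhysics.QuantumLattice.extEvents (Metric.thickening ε (Metric.ball c r)ᶜ)) ⊔
            ⨅ (ε : ℝ) (_ : 0 < ε), Literature.MathematicalPhysics.QuantumLattice.extEvents (Metric.thickening ε (frontier (Metric.ball c r)))) μ F
          =ᵐ[μ] MeasureTheory.condExp (⨅ (ε : ℝ) (_ : 0 < ε), Literature.MathematicalPhysics.QuantumLattice.extEvents (Metric.thickening ε (frontier (Metric.ball c r)))) μ F) →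
      ∀ (c : EuclideanSpace ℝ (Fin 3)) (r : ℝ), 0 < r →
        ∀ A : Set (Literature.MathematicalPhysics.QuantumLattice.FieldConfig (EuclideanSpace ℝ (Fin 3))),
          MeasurableSet[Literature.MathematicalPhysics.QuantumLattice.extEvents (Metric.ball c r)] A →
          ∃ g : Literature.MathematicalPhysics.QuantumLattice.FieldConfig (EuclideanSpace ℝ (Fin 3)) → ENNReal,
            Measurable[Literature.MathematicalPhysics.QuantumLattice.germEvents c r] g ∧
            ∀ B : Set (Literature.MathematicalPhysics.QuantumLattice.FieldConfig (EuclideanSpace ℝ (Fin 3))),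
              MeasurableSet[Literature.MathematicalPhysics.QuantumLattice.extEvents (Metric.closedBall c r)ᶜ] B →
              μ (A ∩ B) = ∫⁻ η in B, g η ∂μ := by
  intro μ hμ hsplit hMI c r hr A hA
  refine exists_germMeasurable_of_forall_shell μ c r fun ε hε => ?_
  obtain ⟨g, hg, hdlr⟩ := exists_shellVersion_of_split_of_MI μ c r (half_pos hε)
    (fun f hf => hsplit c (r + ε / 2) (by linarith) (closedBall c r)ᶜ
      isClosed_closedBall.isOpen_compl f hf)
    (hMI c (r + ε / 2) (by linarith)) hA
  exact ⟨g, hg.mono (extEvents_mono (sdiff_subset_sdiff_left (ball_subset_ball (by linarith))))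
    le_rfl, hdlr⟩

end Summit.CriticalPhenomena.Ising3DConformalLimit.Theorems

end
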